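import Mathlib
import Summits.Ventures.PercRepro2.SameClusterAvoid
import Summits.Ventures.PercRepro2.BHKAvoid

/-!
# The crux for set-avoidance route functions: `2Z·τ_P − y·u_P − x·w_P + x·y ≥ 0`
(blind cell PercRepro2, p5 g35; S4 §2.4 (s) addendum 31)

The crux functional `crossC p c = 2Z·Dv − y·xv − x·yv + c·x·y` is linear in the route function
`g(K) = P(a₁ ↔ v in G ∖ K)` for a fixed constant `c`.  This file proves it for the simplest route
functions, the SET-AVOIDANCE indicators `g = 1[K ∩ P = ∅]` (with `c = 1`): for every finite set
`P` of vertices, with `Q = {a₂ ↮ a₁}`, `Q_P = {a₂ ↮ {a₁} ∪ P}` (`K = C(a₂)`),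

  `2·P(Q)·P(Q_P, o ∈ K, b ∈ K) − P(Q, b ∈ K)·P(Q_P, o ∈ K) − P(Q, o ∈ K)·P(Q_P, b ∈ K)
      + P(Q, o ∈ K)·P(Q, b ∈ K) ≥ 0`                                   (**`avoid_crux_nonneg`**).

PROOF.  Two instances of the same-cluster BHK inequality with set avoidance
(`bhk_same_cluster_events_avoid`): (i) under the avoidance of `{a₁} ∪ P` the memberships of `o`
and `b` are positively associated, `u·w ≤ τ·s` (`s = P(Q_P)`, `u = P(Q_P, o ∈ K)`,
`w = P(Q_P, b ∈ K)`, `τ = P(Q_P, o, b ∈ K)`); (ii) under the avoidance of `a₁` the membership of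
`o` is positively associated with the up-set `{K ∩ P ≠ ∅}`, which reads `u·Z ≤ x·s` after the
complement `Q ∖ Q_P = {Q, K ∩ P ≠ ∅}` is split off (and `w·Z ≤ y·s` likewise).  Then
`s·(2Zτ − yu − xw + xy) ≥ 2Zuw − syu − sxw + sxy =: φ(u, w)`, a BILINEAR form on the box
`[0, xs/Z] × [0, ys/Z]` whose four vertex values are `sxy`, `sxy(1 − s/Z)`, `sxy(1 − s/Z)`,
`sxy` — division-free: `Z²·φ = Z·[A·B + (xs − A)(ys − B) + sxy·(Z − s)]` with `A = xs − uZ ≥ 0`,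
`B = ys − wZ ≥ 0`.  The degenerate cases `Z = 0`, `s = 0` are direct.
Own work; standard axioms.
-/

namespace Summit.Ventures.PercRepro2

namespace CrossAPrimeAvoidCrux

section Avoid

variable {V : Type*} {E : Type*} [Fintype E] [DecidableEq E] [Fintype V] [DecidableEq V]
  {R : Type*} [Field R] [LinearOrder R] [IsStrictOrderedRing R]
variable {ends : E → Sym2 V}

omit [Fintype E] [DecidableEq E] [Fintype V] [DecidableEq V] [LinearOrder R]
  [IsStrictOrderedRing R] in
/-- `{o ∈ C(a₂)}` as a cluster event. -/
lemma connEvent_eq_clusterInEvent_mem (a₂ o : V) :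
    connEvent ends a₂ o = clusterInEvent ends a₂ {A : Set V | o ∈ A} := by
  ext ω
  simp [connEvent, clusterInEvent, cluster]

omit [Fintype E] [DecidableEq E] [Fintype V] [DecidableEq V] [LinearOrder R]
  [IsStrictOrderedRing R] in
/-- `{o, b ∈ C(a₂)}` as a cluster event. -/
lemma connEvent_inter_eq_clusterInEvent_mem (a₂ o b : V) :
    connEvent ends a₂ o ∩ connEvent ends a₂ b =
      clusterInEvent ends a₂ ({A : Set V | o ∈ A} ∩ {A : Set V | b ∈ A}) := by
  ext ω
  simp [connEvent, clusterInEvent, cluster]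

omit [Fintype E] [DecidableEq E] [Fintype V] [DecidableEq V] [LinearOrder R]
  [IsStrictOrderedRing R] in
/-- `{o ∈ ·}` is an up-set. -/
lemma isUpperSet_mem_set (o : V) : IsUpperSet {A : Set V | o ∈ A} := fun _ _ h ho => h ho

omit [Fintype E] [DecidableEq E] [Fintype V] [DecidableEq V] [LinearOrder R]
  [IsStrictOrderedRing R] in
/-- `{K : K ∩ P ≠ ∅}` is an up-set. -/
lemma isUpperSet_hits (P : Finset V) : IsUpperSet {A : Set V | ∃ z ∈ P, z ∈ A} :=
  fun _ _ h ⟨z, hz, hzA⟩ => ⟨z, hz, h hzA⟩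

omit [Fintype E] [DecidableEq E] [Fintype V] [LinearOrder R] [IsStrictOrderedRing R] in
/-- `Q_P = Q ∩ {K ∩ P = ∅}`: the avoidance of `{a₁} ∪ P` is the avoidance of `a₁` together with
the complement of the hitting event. -/
lemma avoidAll_insert_eq (ends : E → Sym2 V) (a₁ a₂ : V) (P : Finset V) :
    avoidAll ends a₂ (insert a₁ P) =
      avoidAll ends a₂ {a₁} ∩ (clusterInEvent ends a₂ {A : Set V | ∃ z ∈ P, z ∈ A})ᶜ := by
  ext ω
  simp only [avoidAll, Set.mem_setOf_eq, Finset.mem_insert, Finset.mem_singleton, Set.mem_inter_iff,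
    Set.mem_compl_iff, mem_clusterInEvent, cluster, forall_eq_or_imp, forall_eq, not_exists,
    not_and]

omit [Fintype V] [LinearOrder R] [IsStrictOrderedRing R] in
/-- Splitting an event along the hitting event of `P`. -/
lemma prob_split_hits (p : E → R) (ends : E → Sym2 V) (a₁ a₂ : V) (P : Finset V)
    (A : Set (Config E)) :
    prob p (avoidAll ends a₂ {a₁} ∩ A) =
      prob p (avoidAll ends a₂ {a₁} ∩ A ∩ clusterInEvent ends a₂ {S : Set V | ∃ z ∈ P, z ∈ S}) +
        prob p (avoidAll ends a₂ (insert a₁ P) ∩ A) := by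
  rw [← prob_inter_add_prob_inter_compl p (avoidAll ends a₂ {a₁} ∩ A)
    (clusterInEvent ends a₂ {S : Set V | ∃ z ∈ P, z ∈ S})]
  congr 2
  rw [avoidAll_insert_eq]
  ext ω
  simp only [Set.mem_inter_iff, Set.mem_compl_iff]
  tauto

/-- **The crux for the set-avoidance route function `g = 1[K ∩ P = ∅]`** (constant `c = 1`):
for every finite `P ⊆ V`, with `Q = {a₂ ↮ a₁}` and `Q_P = {a₂ ↮ {a₁} ∪ P}`,
`2·P(Q)·P(Q_P, o, b ∈ K) − P(Q, b ∈ K)·P(Q_P, o ∈ K) − P(Q, o ∈ K)·P(Q_P, b ∈ K) + P(Q, o ∈ K)·P(Q, b ∈ K) ≥ 0`. -/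
theorem avoid_crux_nonneg (p : E → R) (hp : IsProbVec p) (ends : E → Sym2 V) (o a₁ a₂ b : V)
    (P : Finset V) :
    0 ≤ 2 * prob p (avoidAll ends a₂ {a₁}) *
          prob p (avoidAll ends a₂ (insert a₁ P) ∩ (connEvent ends a₂ o ∩ connEvent ends a₂ b)) -
        prob p (avoidAll ends a₂ {a₁} ∩ connEvent ends a₂ b) *
          prob p (avoidAll ends a₂ (insert a₁ P) ∩ connEvent ends a₂ o) -
        prob p (avoidAll ends a₂ {a₁} ∩ connEvent ends a₂ o) *
          prob p (avoidAll ends a₂ (insert a₁ P) ∩ connEvent ends a₂ b) +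
        prob p (avoidAll ends a₂ {a₁} ∩ connEvent ends a₂ o) *
          prob p (avoidAll ends a₂ {a₁} ∩ connEvent ends a₂ b) := by
  classical
  -- names
  set Z := prob p (avoidAll ends a₂ {a₁}) with hZdef
  set s := prob p (avoidAll ends a₂ (insert a₁ P)) with hsdef
  set x := prob p (avoidAll ends a₂ {a₁} ∩ connEvent ends a₂ o) with hxdef
  set y := prob p (avoidAll ends a₂ {a₁} ∩ connEvent ends a₂ b) with hydef
  set u := prob p (avoidAll ends a₂ (insert a₁ P) ∩ connEvent ends a₂ o) with hudef
  set w := prob p (avoidAll ends a₂ (insert a₁ P) ∩ connEvent ends a₂ b) with hwdef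
  set τ := prob p (avoidAll ends a₂ (insert a₁ P) ∩ (connEvent ends a₂ o ∩ connEvent ends a₂ b))
    with hτdef
  -- (i) positive association of the memberships of `o` and `b` under the avoidance of `{a₁} ∪ P`
  have h1 : u * w ≤ τ * s := by
    have key := bhk_same_cluster_events_avoid p hp ends a₂ (insert a₁ P)
      (isUpperSet_mem_set (V := V) o) (isUpperSet_mem_set (V := V) b)
    rw [← connEvent_eq_clusterInEvent_mem, ← connEvent_eq_clusterInEvent_mem,
      ← connEvent_inter_eq_clusterInEvent_mem, Set.inter_comm (connEvent ends a₂ o),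
      Set.inter_comm (connEvent ends a₂ b), Set.inter_comm (connEvent ends a₂ o ∩ _)] at key
    exact key
  -- (ii) positive association of the membership of `o` with the hitting of `P` under the
  -- avoidance of `a₁`, read through the complement split
  have h2 : u * Z ≤ x * s := by
    have key := bhk_same_cluster_events_avoid p hp ends a₂ {a₁}
      (isUpperSet_mem_set (V := V) o) (isUpperSet_hits (V := V) P)
    rw [← connEvent_eq_clusterInEvent_mem, Set.inter_comm (connEvent ends a₂ o)] at key
    -- `P(Q, K ∩ P ≠ ∅) = Z − s` and `P(Q, o ∈ K, K ∩ P ≠ ∅) = x − u`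
    have e1 := prob_split_hits p ends a₁ a₂ P Set.univ
    have e2 := prob_split_hits p ends a₁ a₂ P (connEvent ends a₂ o)
    simp only [Set.inter_univ] at e1 e2
    have c1 : clusterInEvent ends a₂ {S : Set V | ∃ z ∈ P, z ∈ S} ∩ avoidAll ends a₂ {a₁} =
        avoidAll ends a₂ {a₁} ∩ clusterInEvent ends a₂ {S : Set V | ∃ z ∈ P, z ∈ S} :=
      Set.inter_comm _ _
    have c2 : clusterInEvent ends a₂ ({A : Set V | o ∈ A} ∩ {A : Set V | ∃ z ∈ P, z ∈ A}) ∩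
        avoidAll ends a₂ {a₁} =
        avoidAll ends a₂ {a₁} ∩ connEvent ends a₂ o ∩
          clusterInEvent ends a₂ {S : Set V | ∃ z ∈ P, z ∈ S} := by
      ext ω
      simp only [Set.mem_inter_iff, mem_clusterInEvent, Set.mem_setOf_eq, connEvent, cluster]
      tauto
    rw [c1, c2] at key
    rw [← hZdef] at key e1
    rw [← hsdef] at e1
    rw [← hxdef] at key e2
    rw [← hudef] at e2
    have hH : prob p (avoidAll ends a₂ {a₁} ∩ clusterInEvent ends a₂ {S : Set V | ∃ z ∈ P, z ∈ S}) =
        Z - s := by linarith [e1]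
    have hM : prob p (avoidAll ends a₂ {a₁} ∩ connEvent ends a₂ o ∩
        clusterInEvent ends a₂ {S : Set V | ∃ z ∈ P, z ∈ S}) = x - u := by linarith [e2]
    rw [hH, hM] at key
    nlinarith [key]
  have h3 : w * Z ≤ y * s := by
    have key := bhk_same_cluster_events_avoid p hp ends a₂ {a₁}
      (isUpperSet_mem_set (V := V) b) (isUpperSet_hits (V := V) P)
    rw [← connEvent_eq_clusterInEvent_mem, Set.inter_comm (connEvent ends a₂ b)] at key
    have e1 := prob_split_hits p ends a₁ a₂ P Set.univ
    have e2 := prob_split_hits p ends a₁ a₂ P (connEvent ends a₂ b)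
    simp only [Set.inter_univ] at e1 e2
    have c1 : clusterInEvent ends a₂ {S : Set V | ∃ z ∈ P, z ∈ S} ∩ avoidAll ends a₂ {a₁} =
        avoidAll ends a₂ {a₁} ∩ clusterInEvent ends a₂ {S : Set V | ∃ z ∈ P, z ∈ S} :=
      Set.inter_comm _ _
    have c2 : clusterInEvent ends a₂ ({A : Set V | b ∈ A} ∩ {A : Set V | ∃ z ∈ P, z ∈ A}) ∩
        avoidAll ends a₂ {a₁} =
        avoidAll ends a₂ {a₁} ∩ connEvent ends a₂ b ∩
          clusterInEvent ends a₂ {S : Set V | ∃ z ∈ P, z ∈ S} := by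
      ext ω
      simp only [Set.mem_inter_iff, mem_clusterInEvent, Set.mem_setOf_eq, connEvent, cluster]
      tauto
    rw [c1, c2] at key
    rw [← hZdef] at key e1
    rw [← hsdef] at e1
    rw [← hydef] at key e2
    rw [← hwdef] at e2
    have hH : prob p (avoidAll ends a₂ {a₁} ∩ clusterInEvent ends a₂ {S : Set V | ∃ z ∈ P, z ∈ S}) =
        Z - s := by linarith [e1]
    have hM : prob p (avoidAll ends a₂ {a₁} ∩ connEvent ends a₂ b ∩
        clusterInEvent ends a₂ {S : Set V | ∃ z ∈ P, z ∈ S}) = y - w := by linarith [e2]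
    rw [hH, hM] at key
    nlinarith [key]
  -- bounds
  have hZ : 0 ≤ Z := prob_nonneg hp _
  have hs : 0 ≤ s := prob_nonneg hp _
  have hx : 0 ≤ x := prob_nonneg hp _
  have hy : 0 ≤ y := prob_nonneg hp _
  have hu : 0 ≤ u := prob_nonneg hp _
  have hw : 0 ≤ w := prob_nonneg hp _
  have hτ : 0 ≤ τ := prob_nonneg hp _
  have hsZ : s ≤ Z := prob_mono hp fun ω hω x hx => by
    rw [Finset.mem_singleton] at hx
    rw [hx]
    exact hω a₁ (Finset.mem_insert_self a₁ P)
  have hτs : τ ≤ s := prob_mono hp Set.inter_subset_left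
  have hxZ : x ≤ Z := prob_mono hp Set.inter_subset_left
  have hyZ : y ≤ Z := prob_mono hp Set.inter_subset_left
  have hus : u ≤ s := prob_mono hp Set.inter_subset_left
  have hws : w ≤ s := prob_mono hp Set.inter_subset_left
  -- the bilinear certificate: with `A = xs − uZ ≥ 0`, `B = ys − wZ ≥ 0`,
  -- `Z²·(2Zuw − syu − sxw + sxy) = Z·[A·B + (uZ)(wZ) + sxy(Z − s)]`
  have hA : 0 ≤ x * s - u * Z := by linarith
  have hB : 0 ≤ y * s - w * Z := by linarith
  have hφ : 0 ≤ Z * ((x * s - u * Z) * (y * s - w * Z) + (u * Z) * (w * Z) +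
      s * x * y * (Z - s)) := by
    have k1 := mul_nonneg hA hB
    have k2 := mul_nonneg (mul_nonneg hu hZ) (mul_nonneg hw hZ)
    have k3 := mul_nonneg (mul_nonneg (mul_nonneg hs hx) hy) (sub_nonneg.2 hsZ)
    exact mul_nonneg hZ (by linarith)
  have hcert : Z ^ 2 * (2 * Z * u * w - s * y * u - s * x * w + s * x * y) =
      Z * ((x * s - u * Z) * (y * s - w * Z) + (u * Z) * (w * Z) + s * x * y * (Z - s)) := by
    ring
  -- `s·goal − φ = 2Z·(τs − uw) ≥ 0`
  have hdiff : Z ^ 2 * (s * (2 * Z * τ - y * u - x * w + x * y)) -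
      Z ^ 2 * (2 * Z * u * w - s * y * u - s * x * w + s * x * y) =
      Z ^ 2 * (2 * Z) * (τ * s - u * w) := by ring
  have h0 : 0 ≤ Z ^ 2 * (2 * Z) * (τ * s - u * w) :=
    mul_nonneg (mul_nonneg (sq_nonneg Z) (by linarith)) (by linarith)
  have hmain : 0 ≤ Z ^ 2 * s * (2 * Z * τ - y * u - x * w + x * y) := by
    have : 0 ≤ Z ^ 2 * (s * (2 * Z * τ - y * u - x * w + x * y)) := by
      rw [hcert] at hdiff
      linarith
    rw [mul_assoc]
    exact this
  -- degenerate cases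
  rcases hZ.lt_or_eq with hZp | hZ0
  · rcases hs.lt_or_eq with hsp | hs0
    · have hpos : 0 < Z ^ 2 * s := mul_pos (pow_pos hZp 2) hsp
      by_contra hneg
      have := mul_neg_of_pos_of_neg hpos (not_le.1 hneg)
      linarith
    · -- `s = 0`: then `u = w = τ = 0`
      have hu0 : u = 0 := le_antisymm (by rw [← hs0] at hus; exact hus) hu
      have hw0 : w = 0 := le_antisymm (by rw [← hs0] at hws; exact hws) hw
      have hτ0 : τ = 0 := le_antisymm (by rw [← hs0] at hτs; exact hτs) hτ
      rw [hu0, hw0, hτ0]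
      have := mul_nonneg hx hy
      linarith
  · -- `Z = 0`: every mass vanishes
    have hx0 : x = 0 := le_antisymm (by rw [← hZ0] at hxZ; exact hxZ) hx
    have hy0 : y = 0 := le_antisymm (by rw [← hZ0] at hyZ; exact hyZ) hy
    rw [← hZ0, hx0, hy0]
    have hu0 : u = 0 := le_antisymm (by linarith) hu
    have hw0 : w = 0 := le_antisymm (by linarith) hw
    have hτ0 : τ = 0 := le_antisymm (by linarith) hτ
    rw [hu0, hw0, hτ0]
    linarith

end Avoid

end CrossAPrimeAvoidCrux

end Summit.Ventures.PercRepro2
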